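import Summits.ResolutionOfSingularities.ResolutionOfSingularities.Theorems.PurelyInseparableDim4ResConeCInfTranslatedStraightPrime
import Summits.ResolutionOfSingularities.ResolutionOfSingularities.Theorems.PurelyInseparableDim4ResConeCInfLayerStepPrime
import Summits.ResolutionOfSingularities.ResolutionOfSingularities.Theorems.PurelyInseparableDim4ResConeCInfLevelPinningPrime
import HarnessLib
import HarnessLib.Audit.Tags

/-!
# Purely inseparable four-folds — THE LOOK-AHEAD PINNING OF THE FLAGLESS BRANCH, FOR EVERY PRIME: a translated slot child of a ♯-framed
# state whose own next slot child is in regime has LAYER, hence NO translation (cell `res-dim4-pi`, K2(p) lane, rung-1 POWER-CONE LINE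
# «light pair of TAIL(p, p−1, 3) ∀ p», flagless branch, FILE ♯7 part LA♯; seat res-dim4-typ-1 g6)

[OURS · counted 0 · cell `res-dim4-pi` · K2(p) lane (holder res-dim4-p-12 g5, rulings g5-23 / g5-27); res-dim4-p-3 g6's MEMO FLAGLESS♯ §2–§3
and port plan §6, res-dim4-typ-1 g6's ♯7 design note (bus 2026-08-29 14:20Z).]  Nothing here proves K2(p) for any `p`, any TAIL(p, p−1, 3),
FLAGLESS♯, `NoIsolatedTrap p p`, the Cossart–Jannsen–Saito theorem or resolution of singularities in dimension ≥ 4 / characteristic `p` —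
NOT proved.  AI kernel work, weaker than expert review.  A state-level reading lemma about OUR frame; it ASSUMES the ♯-flag `g ≠ 0` and the
regime-R / LAYER frame (supplied by the ENTRY♯, res-dim4-p-3's side) and says nothing about how a chain reaches that frame.

THE ♯-FRAME of a state `s` (letters `j, i` slots, `u` free, `f` contact; `d + 1 = p`, `4 ≤ d`): `r = x_j x_i ∣ F`, order `d + 2`, straight
(«degree `d + 2` ⇒ the cone `x_j x_i x_f^d`»), EXACT LEDGER («`e_f ≤ d − 1 ⇒ e_j, e_i ≥ 2`»), REGIME R («`e_f + 2 ≤ d ⇒ e_j, e_i ≥ 3`»), LAYER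
(«no monomial of degree `d + 3` with `e_f + 2 ≤ d`»), the dead ROW «no monomial of `(u, f)`-bidegree `(d − 3, 0)` below degree `N`»,
`N ≥ d + 5`, and the ♯-FLAG `g = coeff_{x_j³x_i³x_u^{d−2}} F ≠ 0`.
**`sharp_pin_of_lookahead_prime`**: if the translated slot child `s₁ = step p univ j (update 0 u β) s` has order `d + 2` and `e_G = 3`, and
ITS translated slot child `s₂ = step p univ ℓ₂ (update 0 u β′) s₁` (`ℓ₂ ∈ {j, i}`, any `β′`) has order `d + 2` and `e_G = 3`, then
**`β = 0`** and `s₁` has LAYER.  ROUTE: `s₁` and `s₂` are straight with the exact ledger (`translated_child_frame_prime`, twice) ⇒ ♯2b's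
`hreg₂`; regime R in the `i`-slot passes to `s₁` (`le_apply_of_step_translate_other`) so `s₁` carries no `κ`-killer; LAYER of `s₁` by
res-dim4-p-3's ♯2b `layer_step_same_prime` / `layer_step_change_prime`; then ♯1's `coeff_sharp_step_translate_u` reads
`0 = (d − 2)·β·g + coeff_{x_j⁴x_i³x_u^{d−3}} F`, the last coefficient dead by the ROW, `g ≠ 0`, `(d − 2 : K) ≠ 0` ⇒ `β = 0`.
The `i`-slot edition is this statement with `j ↔ i`.
[cite: CossartJannsenSaito2020, Thm. 3.14, Lemma 13.2] [cite: Hauser2010, §§F–G]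
bears_on: LADDER-RESOLUTION:D157-DOOR2 (res-dim4-pi · K2(p) · power cones · flagless branch ♯7 look-ahead pinning).  Supports
stmt-ResolutionOfSingularities-16155 (helper).
-/

set_option linter.dupNamespace false -- mandated namespace of this single-conjunct summit

noncomputable section

namespace Summit.ResolutionOfSingularities.ResolutionOfSingularities.Theorems.PIDim4

namespace ResCone

open MvPolynomial Finset
open Literature.AlgebraicGeometry.Resolution
open Literature.AlgebraicGeometry.Resolution.CentreBlowup
open Literature.AlgebraicGeometry.Resolution.Hauser2010
open Literature.AlgebraicGeometry.Resolution.HauserPerlega2019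

variable {K : Type} [Field K]

/-- The cone exponent does not see the order of the two slot letters. [OURS · bookkeeping] -/
theorem cone_comm (j i u f : Fin 4) (d : ℕ) :
    (Finsupp.single i 1 + Finsupp.single j 1 + Finsupp.single u 0 + Finsupp.single f d : Fin 4 →₀ ℕ) =
      Finsupp.single j 1 + Finsupp.single i 1 + Finsupp.single u 0 + Finsupp.single f d := by
  rw [add_comm (Finsupp.single i 1) (Finsupp.single j 1)]

/-- **`hreg₂` from order and support-straightness**: every monomial of a straight state of order `d + 2` has degree `≥ d + 3` or is the
cone. [OURS · bookkeeping] -/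
theorem reg_of_straight {j i u f : Fin 4} {s : State K} {d : ℕ} (ho : ordZero s.F = ((d + 2 : ℕ) : ℕ∞))
    (hstraight : ∀ e ∈ s.F.support, e.degree = d + 2 →
      e = Finsupp.single j 1 + Finsupp.single i 1 + Finsupp.single u 0 + Finsupp.single f d) :
    ∀ E ∈ s.F.support, d + 3 ≤ E.degree ∨ E = Finsupp.single j 1 + Finsupp.single i 1 + Finsupp.single u 0 + Finsupp.single f d := by
  intro E hE
  have h := le_degree_of_mem_support_of_ordZero ho hE
  rcases Nat.lt_or_ge E.degree (d + 3) with hlt | hge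
  · exact Or.inr (hstraight E hE (by omega))
  · exact Or.inl hge

section Letters

variable [DecidableEq K] {j i u f : Fin 4} (hji : j ≠ i) (hju : j ≠ u) (hjf : j ≠ f) (hiu : i ≠ u) (hif : i ≠ f) (huf : u ≠ f)
include hji hju hjf hiu hif huf

/-- **THE LOOK-AHEAD PINNING OF THE FLAGLESS BRANCH, every prime** (module docstring): `β = 0` and LAYER of the child. [OURS]
[cite: CossartJannsenSaito2020, Thm. 3.14, Lemma 13.2] [cite: Hauser2010, §§F–G] -/
theorem sharp_pin_of_lookahead_prime (p : ℕ) [Fact p.Prime] [CharP K p] {d : ℕ} (hdp : d + 1 = p) (hd4 : 4 ≤ d)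
    {s : State K} (hr : s.r = Finsupp.single j 1 + Finsupp.single i 1) (hdiv : ∀ e ∈ s.F.support, s.r ≤ e)
    (ho : ordZero s.F = ((d + 2 : ℕ) : ℕ∞))
    (hstraight : ∀ e ∈ s.F.support, e.degree = d + 2 →
      e = Finsupp.single j 1 + Finsupp.single i 1 + Finsupp.single u 0 + Finsupp.single f d)
    (hled : ∀ e ∈ s.F.support, e f ≤ d - 1 → 2 ≤ e j ∧ 2 ≤ e i)
    (hRj : ∀ e ∈ s.F.support, e f + 2 ≤ d → 3 ≤ e j) (hRi : ∀ e ∈ s.F.support, e f + 2 ≤ d → 3 ≤ e i)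
    (hlayer : ∀ E : Fin 4 →₀ ℕ, E.degree = d + 3 → E f + 2 ≤ d → coeff E s.F = 0)
    {N : ℕ} (hN : d + 5 ≤ N) (hrow : ∀ e ∈ s.F.support, e.degree < N → ¬ (e u = d - 3 ∧ e f = 0))
    (hg : coeff (Finsupp.single j 3 + Finsupp.single i 3 + Finsupp.single u (d - 2) + Finsupp.single f 0) s.F ≠ 0) (β : K)
    (ho₁ : ordZero (CentreBlowup.step p Finset.univ j (Function.update (0 : Fin 4 → K) u β) s).F = ((d + 2 : ℕ) : ℕ∞))
    (he3₁ : Module.finrank K (resVertex (CentreBlowup.step p Finset.univ j (Function.update (0 : Fin 4 → K) u β) s)) = 3)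
    {ℓ₂ : Fin 4} (hℓ₂ : ℓ₂ = j ∨ ℓ₂ = i) (β' : K)
    (ho₂ : ordZero (CentreBlowup.step p Finset.univ ℓ₂ (Function.update (0 : Fin 4 → K) u β')
      (CentreBlowup.step p Finset.univ j (Function.update (0 : Fin 4 → K) u β) s)).F = ((d + 2 : ℕ) : ℕ∞))
    (he3₂ : Module.finrank K (resVertex (CentreBlowup.step p Finset.univ ℓ₂ (Function.update (0 : Fin 4 → K) u β')
      (CentreBlowup.step p Finset.univ j (Function.update (0 : Fin 4 → K) u β) s))) = 3) :
    β = 0 ∧ ∀ E : Fin 4 →₀ ℕ, E.degree = d + 3 → E f + 2 ≤ d →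
      coeff E (CentreBlowup.step p Finset.univ j (Function.update (0 : Fin 4 → K) u β) s).F = 0 := by
  classical
  have hp : p.Prime := Fact.out
  have hd2 : 2 ≤ d := by omega
  set s₁ := CentreBlowup.step p Finset.univ j (Function.update (0 : Fin 4 → K) u β) s with hs₁
  have hq : ((p : ℕ) : ℕ∞) ≤ ordAlong Finset.univ s.F := by
    rw [ordAlong_univ, ho]; exact_mod_cast (by omega : p ≤ d + 2)
  have h6 : ∀ e ∈ s.F.support, d + 2 ≤ e.degree := fun e he => le_degree_of_mem_support_of_ordZero ho he
  -- (1) the translated child is framed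
  obtain ⟨hr₁, hdiv₁, hled₁, ⟨a₁, ha₁, hform₁⟩, hstraight₁⟩ :=
    translated_child_frame_prime hji hju hjf hiu hif huf p hdp hd2 hr hdiv ho hstraight hled β ho₁ he3₁
  have hq₁ : ((p : ℕ) : ℕ∞) ≤ ordAlong Finset.univ s₁.F := by
    rw [ordAlong_univ, ho₁]; exact_mod_cast (by omega : p ≤ d + 2)
  -- regime R in the `i`-slot passes to the child: no `κ`-killer
  have hRi₁ : ∀ E ∈ s₁.F.support, E f + 2 ≤ d → 3 ≤ E i :=
    le_apply_of_step_translate_other hji.symm hiu hif hju hjf huf p s hq hRi β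
  -- (2) LAYER of the child, by the look-ahead through the grandchild
  have hlayer₁ : ∀ E : Fin 4 →₀ ℕ, E.degree = d + 3 → E f + 2 ≤ d → coeff E s₁.F = 0 := by
    rcases hℓ₂ with rfl | rfl
    · -- same letter: the grandchild is framed in the letters `j, i`
      obtain ⟨-, -, -, -, hstraight₂⟩ :=
        translated_child_frame_prime hji hju hjf hiu hif huf p hdp hd2 hr₁ hdiv₁ ho₁ hstraight₁ hled₁ β' ho₂ he3₂
      exact layer_step_same_prime hji hju hjf hiu hif huf p hdp hd2 s hq h6 hstraight hlayer β β' hq₁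
        (reg_of_straight ho₂ hstraight₂)
    · -- letter change: the grandchild is framed in the letters `i, j`
      have hr₁' : s₁.r = Finsupp.single ℓ₂ 1 + Finsupp.single j 1 := by rw [hr₁, add_comm]
      have hstraight₁' : ∀ e ∈ s₁.F.support, e.degree = d + 2 →
          e = Finsupp.single ℓ₂ 1 + Finsupp.single j 1 + Finsupp.single u 0 + Finsupp.single f d :=
        fun e he hdeg => (hstraight₁ e he hdeg).trans (cone_comm ℓ₂ j u f d)
      have hled₁' : ∀ e ∈ s₁.F.support, e f ≤ d - 1 → 2 ≤ e ℓ₂ ∧ 2 ≤ e j := fun e he hf => (hled₁ e he hf).symm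
      obtain ⟨-, -, -, -, hstraight₂⟩ :=
        translated_child_frame_prime hji.symm hiu hif hju hjf huf p hdp hd2 hr₁' hdiv₁ ho₁ hstraight₁' hled₁' β' ho₂ he3₂
      have hreg₂ := reg_of_straight ho₂ hstraight₂
      have hnokill : ∀ a c : ℕ, 3 ≤ a → c + 2 ≤ d → a ≤ d + 1 - c →
          coeff (Finsupp.single j a + Finsupp.single ℓ₂ 2 + Finsupp.single u (d + 1 - c - a) + Finsupp.single f c) s₁.F = 0 := by
        intro a c _ hc _
        by_contra hne
        have hE := hRi₁ _ (mem_support_iff.mpr hne) (by rw [(quad_apply hji hju hjf hiu hif huf a 2 (d + 1 - c - a) c).2.2.2]; exact hc)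
        rw [(quad_apply hji hju hjf hiu hif huf a 2 (d + 1 - c - a) c).2.1] at hE
        omega
      exact layer_step_change_prime hji hju hjf hiu hif huf p hdp hd2 s hq h6 hstraight hled hlayer β β' hq₁ hnokill
        (fun E hE => (hreg₂ E hE).imp_right fun h => h.trans (cone_comm ℓ₂ j u f d).symm)
  refine ⟨?_, hlayer₁⟩
  -- (3) the pinning identity
  have hpin := coeff_sharp_step_translate_u hji hju hjf hiu hif huf p hdp hd4 s hq (fun e he hf => hRj e he (by omega)) β
  have hdeg3 : (Finsupp.single j 3 + Finsupp.single i 3 + Finsupp.single u (d - 3) + Finsupp.single f 0 : Fin 4 →₀ ℕ).degree = d + 3 := by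
    simp only [map_add, Finsupp.degree_single]; omega
  have hL : coeff (Finsupp.single j 3 + Finsupp.single i 3 + Finsupp.single u (d - 3) + Finsupp.single f 0) s₁.F = 0 :=
    hlayer₁ _ hdeg3 (by rw [(quad_apply hji hju hjf hiu hif huf 3 3 (d - 3) 0).2.2.2]; omega)
  have hrowdead : coeff (Finsupp.single j 4 + Finsupp.single i 3 + Finsupp.single u (d - 3) + Finsupp.single f 0) s.F = 0 := by
    by_contra hne
    obtain ⟨-, -, hu3, hf0⟩ := quad_apply hji hju hjf hiu hif huf 4 3 (d - 3) 0
    refine hrow _ (mem_support_iff.mpr hne) ?_ ⟨hu3, hf0⟩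
    simp only [map_add, Finsupp.degree_single]; omega
  have hdK : ((d - 2 : ℕ) : K) ≠ 0 := fun h =>
    Nat.not_dvd_of_pos_of_lt (by omega) (by omega : d - 2 < p) ((CharP.cast_eq_zero_iff K p (d - 2)).mp h)
  rw [hL, hrowdead, add_zero] at hpin
  have h := mul_eq_zero.mp hpin.symm
  rcases h with h | h
  · rcases mul_eq_zero.mp h with h | h
    · exact absurd h hdK
    · exact h
  · exact absurd h hg

/-- **THE LOOK-AHEAD LAYER ALONE, any row** (appended; holder g5-26 «pinning by value»): the row-independent half of
`sharp_pin_of_lookahead_prime` — a translated slot child in regime of a LAYER / regime-R / straight / exact-ledger parent, whose own next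
translated slot child is in regime, has LAYER.  No ♯-flag, no dead row, no pivot: those enter the ♯-window only through the pinning hypothesis it
takes by value. [OURS] [cite: CossartJannsenSaito2020, Thm. 3.14, Lemma 13.2] [cite: Hauser2010, §§F–G] -/
theorem layer_of_lookahead_prime (p : ℕ) [Fact p.Prime] [CharP K p] {d : ℕ} (hdp : d + 1 = p) (hd2 : 2 ≤ d)
    {s : State K} (hr : s.r = Finsupp.single j 1 + Finsupp.single i 1) (hdiv : ∀ e ∈ s.F.support, s.r ≤ e)
    (ho : ordZero s.F = ((d + 2 : ℕ) : ℕ∞))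
    (hstraight : ∀ e ∈ s.F.support, e.degree = d + 2 →
      e = Finsupp.single j 1 + Finsupp.single i 1 + Finsupp.single u 0 + Finsupp.single f d)
    (hled : ∀ e ∈ s.F.support, e f ≤ d - 1 → 2 ≤ e j ∧ 2 ≤ e i)
    (hRi : ∀ e ∈ s.F.support, e f + 2 ≤ d → 3 ≤ e i)
    (hlayer : ∀ E : Fin 4 →₀ ℕ, E.degree = d + 3 → E f + 2 ≤ d → coeff E s.F = 0) (β : K)
    (ho₁ : ordZero (CentreBlowup.step p Finset.univ j (Function.update (0 : Fin 4 → K) u β) s).F = ((d + 2 : ℕ) : ℕ∞))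
    (he3₁ : Module.finrank K (resVertex (CentreBlowup.step p Finset.univ j (Function.update (0 : Fin 4 → K) u β) s)) = 3)
    {ℓ₂ : Fin 4} (hℓ₂ : ℓ₂ = j ∨ ℓ₂ = i) (β' : K)
    (ho₂ : ordZero (CentreBlowup.step p Finset.univ ℓ₂ (Function.update (0 : Fin 4 → K) u β')
      (CentreBlowup.step p Finset.univ j (Function.update (0 : Fin 4 → K) u β) s)).F = ((d + 2 : ℕ) : ℕ∞))
    (he3₂ : Module.finrank K (resVertex (CentreBlowup.step p Finset.univ ℓ₂ (Function.update (0 : Fin 4 → K) u β')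
      (CentreBlowup.step p Finset.univ j (Function.update (0 : Fin 4 → K) u β) s))) = 3) :
    ∀ E : Fin 4 →₀ ℕ, E.degree = d + 3 → E f + 2 ≤ d →
      coeff E (CentreBlowup.step p Finset.univ j (Function.update (0 : Fin 4 → K) u β) s).F = 0 := by
  classical
  set s₁ := CentreBlowup.step p Finset.univ j (Function.update (0 : Fin 4 → K) u β) s with hs₁
  have hq : ((p : ℕ) : ℕ∞) ≤ ordAlong Finset.univ s.F := by
    rw [ordAlong_univ, ho]; exact_mod_cast (by omega : p ≤ d + 2)
  have h6 : ∀ e ∈ s.F.support, d + 2 ≤ e.degree := fun e he => le_degree_of_mem_support_of_ordZero ho he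
  obtain ⟨hr₁, hdiv₁, hled₁, -, hstraight₁⟩ :=
    translated_child_frame_prime hji hju hjf hiu hif huf p hdp hd2 hr hdiv ho hstraight hled β ho₁ he3₁
  have hq₁ : ((p : ℕ) : ℕ∞) ≤ ordAlong Finset.univ s₁.F := by
    rw [ordAlong_univ, ho₁]; exact_mod_cast (by omega : p ≤ d + 2)
  have hRi₁ : ∀ E ∈ s₁.F.support, E f + 2 ≤ d → 3 ≤ E i :=
    le_apply_of_step_translate_other hji.symm hiu hif hju hjf huf p s hq hRi β
  rcases hℓ₂ with rfl | rfl
  · obtain ⟨-, -, -, -, hstraight₂⟩ :=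
      translated_child_frame_prime hji hju hjf hiu hif huf p hdp hd2 hr₁ hdiv₁ ho₁ hstraight₁ hled₁ β' ho₂ he3₂
    exact layer_step_same_prime hji hju hjf hiu hif huf p hdp hd2 s hq h6 hstraight hlayer β β' hq₁ (reg_of_straight ho₂ hstraight₂)
  · have hr₁' : s₁.r = Finsupp.single ℓ₂ 1 + Finsupp.single j 1 := by rw [hr₁, add_comm]
    have hstraight₁' : ∀ e ∈ s₁.F.support, e.degree = d + 2 →
        e = Finsupp.single ℓ₂ 1 + Finsupp.single j 1 + Finsupp.single u 0 + Finsupp.single f d :=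
      fun e he hdeg => (hstraight₁ e he hdeg).trans (cone_comm ℓ₂ j u f d)
    have hled₁' : ∀ e ∈ s₁.F.support, e f ≤ d - 1 → 2 ≤ e ℓ₂ ∧ 2 ≤ e j := fun e he hf => (hled₁ e he hf).symm
    obtain ⟨-, -, -, -, hstraight₂⟩ :=
      translated_child_frame_prime hji.symm hiu hif hju hjf huf p hdp hd2 hr₁' hdiv₁ ho₁ hstraight₁' hled₁' β' ho₂ he3₂
    have hreg₂ := reg_of_straight ho₂ hstraight₂
    have hnokill : ∀ a c : ℕ, 3 ≤ a → c + 2 ≤ d → a ≤ d + 1 - c →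
        coeff (Finsupp.single j a + Finsupp.single ℓ₂ 2 + Finsupp.single u (d + 1 - c - a) + Finsupp.single f c) s₁.F = 0 := by
      intro a c _ hc _
      by_contra hne
      have hE := hRi₁ _ (mem_support_iff.mpr hne) (by rw [(quad_apply hji hju hjf hiu hif huf a 2 (d + 1 - c - a) c).2.2.2]; exact hc)
      rw [(quad_apply hji hju hjf hiu hif huf a 2 (d + 1 - c - a) c).2.1] at hE
      omega
    exact layer_step_change_prime hji hju hjf hiu hif huf p hdp hd2 s hq h6 hstraight hled hlayer β β' hq₁ hnokill
      (fun E hE => (hreg₂ E hE).imp_right fun h => h.trans (cone_comm ℓ₂ j u f d).symm)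

/-- **THE PINNING HYPOTHESIS OF THE ♯-WINDOW, INSTANCE ROW `0`** (appended): the closed statement the ♯-window files take BY VALUE (holder
g5-26), discharged at the row `c = 0` — the `d = 6` witness position — by res-dim4-p-3's ♯1 `coeff_sharp_step_translate_u`: parent of order
`d + 2` with regime R on the `x_f`-free `j`-exponents, cross entry `x_j⁴x_i³x_u^{d−3}` dead, ♯-flag `x_j³x_i³x_u^{d−2} ≠ 0`, and the child's
LAYER entry `x_j³x_i³x_u^{d−3}` dead ⇒ `β = 0`.  Other rows: res-dim4-p-3's `coeff_level_step_translate_u` at level `2`. [OURS]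
[cite: CossartJannsenSaito2020, Thm. 3.14] -/
theorem sharp_pinning_row_zero_prime (p : ℕ) [Fact p.Prime] [CharP K p] {d : ℕ} (hdp : d + 1 = p) (hd4 : 4 ≤ d)
    (B : State K) (β : K) (ho : ordZero B.F = ((d + 2 : ℕ) : ℕ∞)) (hR : ∀ e ∈ B.F.support, e f = 0 → 3 ≤ e j)
    (hcross : coeff (Finsupp.single j 4 + Finsupp.single i 3 + Finsupp.single u (d - 3 - 0) + Finsupp.single f 0) B.F = 0)
    (hg : coeff (Finsupp.single j 3 + Finsupp.single i 3 + Finsupp.single u (d - 2 - 0) + Finsupp.single f 0) B.F ≠ 0)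
    (hchild : coeff (Finsupp.single j 3 + Finsupp.single i 3 + Finsupp.single u (d - 3 - 0) + Finsupp.single f 0)
      (CentreBlowup.step p Finset.univ j (Function.update (0 : Fin 4 → K) u β) B).F = 0) : β = 0 := by
  have hq : ((p : ℕ) : ℕ∞) ≤ ordAlong Finset.univ B.F := by
    rw [ordAlong_univ, ho]; exact_mod_cast (by omega : p ≤ d + 2)
  rw [Nat.sub_zero] at hcross hg hchild
  have hpin := coeff_sharp_step_translate_u hji hju hjf hiu hif huf p hdp hd4 B hq hR β
  rw [hchild, hcross, add_zero] at hpin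
  have hdK : ((d - 2 : ℕ) : K) ≠ 0 := fun h =>
    Nat.not_dvd_of_pos_of_lt (by omega) (by omega : d - 2 < p) ((CharP.cast_eq_zero_iff K p (d - 2)).mp h)
  rcases mul_eq_zero.mp hpin.symm with h | h
  · rcases mul_eq_zero.mp h with h | h
    · exact absurd h hdK
    · exact h
  · exact absurd h hg

/-- **THE PINNING HYPOTHESIS OF THE ♯-WINDOW, EVERY ROW `ef` OF LEVEL 2** (appended): the closed statement the ♯-window files take BY VALUE,
discharged for every row by res-dim4-p-3's `translation_eq_zero_of_level` at `k = 2` (numerals `2 + 2`, `2 + 1`, `d − 2 − 1 − ef` read as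
`4`, `3`, `d − 3 − ef`). [OURS] [cite: CossartJannsenSaito2020, Thm. 3.14] -/
theorem sharp_pinning_row_prime (p : ℕ) [CharP K p] {d ef : ℕ} (hdp : d + 1 = p) (hef : ef + 3 ≤ d)
    (B : State K) (β : K) (ho : ordZero B.F = ((d + 2 : ℕ) : ℕ∞)) (hR : ∀ e ∈ B.F.support, e f = ef → 3 ≤ e j)
    (hcross : coeff (Finsupp.single j 4 + Finsupp.single i 3 + Finsupp.single u (d - 3 - ef) + Finsupp.single f ef) B.F = 0)
    (hg : coeff (Finsupp.single j 3 + Finsupp.single i 3 + Finsupp.single u (d - 2 - ef) + Finsupp.single f ef) B.F ≠ 0)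
    (hchild : coeff (Finsupp.single j 3 + Finsupp.single i 3 + Finsupp.single u (d - 3 - ef) + Finsupp.single f ef)
      (CentreBlowup.step p Finset.univ j (Function.update (0 : Fin 4 → K) u β) B).F = 0) : β = 0 := by
  have hq : ((p : ℕ) : ℕ∞) ≤ ordAlong Finset.univ B.F := by
    rw [ordAlong_univ, ho]; exact_mod_cast (by omega : p ≤ d + 2)
  have h31 : d - 2 - 1 - ef = d - 3 - ef := by omega
  refine translation_eq_zero_of_level hji hju hjf hiu hif huf p hdp 2 ef (by omega) (by omega) B hq hR β ?_ ?_ ?_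
  · rw [h31]; exact hcross
  · exact hg
  · rw [h31]; exact hchild

end Letters

end ResCone

end Summit.ResolutionOfSingularities.ResolutionOfSingularities.Theorems.PIDim4

end
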